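import Literature.MathematicalPhysics.QuantumFieldTheory.Balaban1983to89.B9SectBH1GReadWriteY

/-!
# `Balaban1983to89.B9SectBH1GUndiffY` — THE UNDIFFERENTIATED BOND PROBE `ζ·G(U)Λ` of the (3.43) reading (r06's right-transfer premise (a′), bond sector): the
# DISPLAYED covariant-Lipschitz law `HolderLipBY` of a bond transporter on admissible pairs and ★★ `probeB_undiff_le` — the product rule for def-Y's `holderQB` pair
# term from a sup of `Ψ`, a sup of its covariant differences, the cut-off class `|ζ| + ‖ζ‖^ξ_α`, and the law

T. Bałaban, *Propagators for lattice gauge theories in a background field*, Commun. Math. Phys. **99** (1985) 389–434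
[`Balaban1985BackgroundPropagators`, "B9"]; [4] = T. Bałaban, *Propagators and renormalization transformations for lattice gauge
theories. II*, Commun. Math. Phys. **96** (1984) 223–250 [`Balaban1984PropagatorsII`].

statement-level skeleton of published theorems with citation tags; proofs where landed; nothing here is a claim about the
Yang–Mills mass gap

THE PRINTED LOCI.  (3.40) p. 397 (*"R(U(Γ_{x,x′})) … where Γ_{x,x′} is a shortest contour connecting points x and x′"*, pairs `|x − x′| ≦ 1` on the `ξ`-lattice);
(3.42)–(3.43) pp. 397–398 (the sup members dominate the Hölder members of the undifferentiated operator: the premise `‖Φ(G(U)μ)‖ ≦ B_h(Lʲη)^{2−β}…` of the right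
transfer of Sect. B for Thm 3.3's `G`, p. 403 with p. 407 (3.86)); (3.3) p. 390 (the covariant difference, physical units `c_f`); [4] (2.137) p. 247 (admissible pairs,
the pair parameter `t`), (2.2) p. 224 with Lemma 2.1 (2.60) p. 234 (neighbouring blocks differ by at most one level).

WHY THIS FILE (seat dag-n06-c gen 14; bond twin of gen 12's `B9SectBH1ProbesY` §6–§7).  r06's RIGHT (3.43) transfer for the bond family
(`B9SectBH1GFrameV5.H1GFrame₅.h1G_transfer`, premise (a′)) asks for the pair probe of the UNDIFFERENTIATED `G(U)Λ` with the weight `(Lʲη)^{2−γ}`, which no displayed block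
of Theorem 3.3 carries; print derives it from the sup members (3.42)₀,₁ by the elementary fact that a covariant difference quotient is at most the contour length times
the sup of the covariant differences along the contour.  For def-Y's BOND quotient `holderQB` (admissible pairs `(x, x′)`: same direction, `|x − x′|_∞ ≦ L^{j(y(x))}`,
`≦ L^{j(y(x′))}`; Δ̃-wide cut-offs) the two ingredients are:
* §1 ★ `HolderLipBY cLip rL par U` (def) — THE DISPLAYED LAW: for every bond function `Ψ` and every admissible pair, `‖Ψ(x) − R(par x x′)Ψ(x′)‖ ≦
  c_Lip·(|x−x′|_∞η)·sup{‖(∇_{U,μ}Ψ)(q)‖ : μ, q with d_T(y(q), y(x)) ≦ r_L}` — the telescoping along the taxicab contour from `x` to `x′` (for def-Y's `parBY` =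
  n06-w6's `B9Eq340TaxiTelescope.norm_sub_R_parTaxiV_le` once the contour's rungs are shown to lie in blocks within `r_L` of `y(x)` — NOT done here; DISPLAYED);
* §2 the cut-off class of a bond cut-off (`cutH_inr_eq`, `abs_le_cutSup`, `pair_le_holderSemi`), the weight identity `wB_eq_tpar_mul` (`(|x−x′|η)^{−α} = t^{−α}·(L^{j(x)}η)^{−α}`,
  as dag-n06-d's `B9CoReadingCoordsHolder.wK_eq_tpar_mul`);
* §3 ★★ `probeB_undiff_le` — THE PRODUCT RULE: for a cut-off `ζ` supported within block distance 1 of `βy` (`cutInT`), a transporter of unit norms obeying the law, and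
  `Ψ` with `‖Ψ(q)‖ ≦ A₀` on blocks within 1 of `βy`, `‖(∇_{U,μ}Ψ)(q)‖ ≦ A₁` on blocks within `r_L + 1` of `βy`, scale lengths of the blocks within 1 of `βy` in `[Λ₀, Λ₁]`
  (`0 < Λ₀`), `0 ≦ α ≦ 1`: every admissible pair probe of `ζ·Ψ` is at most `(|ζ| + ‖ζ‖^ξ_α)·(Λ₀^{−α}·A₀ + c_Lip·Λ₁^{1−α}·A₁)` — per pair
  `ζ(x)Ψ(x) − R(ζ(x′)Ψ(x′)) = ζ(x)(Ψ(x) − RΨ(x′)) + (ζ(x) − ζ(x′))RΨ(x′)` when `ζ(x) ≠ 0 ≠ ζ(x′)`, one term otherwise, the weight normalised at whichever bond carries `ζ ≠ 0`.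
HONEST SCOPE.  Elementary bookkeeping; the transporter law is a named HYPOTHESIS, not proved; nothing of [B9] asserted; COUNT-NEUTRAL; N06 NOT discharged; one
finite lattice programme at fixed ε — nothing continuum, nothing about OS positivity or the mass gap.  No `sorry`, no `axiom`, no `instance`, no `notation`; one
`def … : Prop` with parameters (the law).  Seat `pub-ymgap-dag-n06-c` (g14), 2026-08-28; `--supports stmt-QuantumFields-27364`.

RELATED IN THE TREE, NOT DUPLICATED: `B9SectBH1ProbesY.HolderLipY` ∕ `quot_undiff_le` (site twin), `B9Eq340TaxiTelescope` (n06-w6; the discharge route),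
`B9CoReadingCoordsHolder.holderQB_le_of_probes` (dag-n06-d: the product rule with uniformly bounded anchored probes — a different contract), `Node00.OpsYHolderFar`.
-/

noncomputable section

namespace Literature.MathematicalPhysics.QuantumFieldTheory.Balaban1983to89.B9SectBH1GUndiffY

open LatticeFieldCalculus (supDist)
open B9Eq39Adjoint (R R_smul R_zero R_sub R_add)
open B6GlobalChartV1 (PV blkV1)
open B6Geom246MultiLevelTorus (geomT)
open B6Ineq2142KLevelV1 (β)
open B6KLevelCensusIndexV1 (KIdx Adm adm_symm tpar tpar_nonneg tpar_le_one)
open B9GeoNormsKLevelV1 (geo9K)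
open B9Eq310Hermitian (norm_R_le)
open Node00 (FBondY IBondY CfgY cdB holderQB)
open B9SectBH1GReadWriteY (wB wB_nonneg wB_comm probeB norm_probeB)
open B9Thm37CubeCoverCommutatorSizes (norm_ofReal_smul)

variable {d ℓ : ℕ} {hd : 1 ≤ d + 1} {hL : Odd (ℓ + 1) ∧ 1 < ℓ + 1} {b₀ b₁ : ℝ}
variable {𝔸 : Type} [NormedRing 𝔸] [NormedAlgebra ℂ 𝔸] [CompleteSpace 𝔸]
variable (i : KIdx d ℓ hd hL b₀ b₁)

/-! ## §1 The displayed transporter law: covariant Lipschitz on admissible pairs -/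

open Classical in
/-- the sup of the covariant differences `‖(∇_{U,μ}Ψ)(q)‖` over all directions and all bonds `q` whose block is within `d_T ≤ r` of the block `s`.
[cite: Balaban1985BackgroundPropagators, (3.3) p.390, (3.42) p.397 («sup_{x ∈ Δ}»), bookkeeping] -/
def gradSupB (r : ℝ) (U : CfgY 𝔸 i) (Ψ : FBondY i → 𝔸) (s : ↥(B6Geom246MultiLevelBox.bset i.D.toDomains)) : ℝ :=
  ⨆ p : FBondY i × Fin (d + 1), if (geomT i.D).dist (blkV1 i.hN i.D p.1) s ≤ r then ‖cdB i U p.2 Ψ p.1‖ else 0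

/-- `0 ≤ gradSupB`. [cite: Balaban1985BackgroundPropagators, (3.42) p.397, bookkeeping] -/
theorem gradSupB_nonneg (r : ℝ) (U : CfgY 𝔸 i) (Ψ : FBondY i → 𝔸) (s : ↥(B6Geom246MultiLevelBox.bset i.D.toDomains)) : 0 ≤ gradSupB i r U Ψ s := by
  classical
  unfold gradSupB
  refine Real.iSup_nonneg fun p => ?_
  split_ifs
  · exact norm_nonneg _
  · exact le_rfl

/-- intro rule: a bound `A ≥ 0` on every `‖(∇_{U,μ}Ψ)(q)‖` with `d_T(y(q), s) ≤ r` bounds `gradSupB`. [cite: Balaban1985BackgroundPropagators, (3.42) p.397, bookkeeping] -/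
theorem gradSupB_le (r : ℝ) (U : CfgY 𝔸 i) (Ψ : FBondY i → 𝔸) (s : ↥(B6Geom246MultiLevelBox.bset i.D.toDomains)) {A : ℝ} (hA : 0 ≤ A)
    (h : ∀ (q : FBondY i) (μ : Fin (d + 1)), (geomT i.D).dist (blkV1 i.hN i.D q) s ≤ r → ‖cdB i U μ Ψ q‖ ≤ A) : gradSupB i r U Ψ s ≤ A := by
  classical
  unfold gradSupB
  refine Real.iSup_le (fun p => ?_) hA
  split_ifs with hp
  · exact h p.1 p.2 hp
  · exact hA

/-- ★ **THE COVARIANT LIPSCHITZ LAW OF A BOND TRANSPORTER ON ADMISSIBLE PAIRS** (named hypothesis): for every bond function `Ψ` and every ADMISSIBLE pair `(x, x′)`,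
`‖Ψ(x) − R(par x x′)Ψ(x′)‖ ≦ c_Lip·(|x − x′|_∞·η)·gradSupB r_L U Ψ (y(x))` (`η = |c_f|⁻¹`) — the telescoping of the transported difference along the taxicab contour
from `x` to `x′`, whose rungs lie in blocks within `r_L` of the block of `x`.  For def-Y's `parBY` this is n06-w6's `B9Eq340TaxiTelescope.norm_sub_R_parTaxiV_le` plus
the locality of the contour; here it is DISPLAYED. [cite: Balaban1985BackgroundPropagators, (3.40) p.397 («U(Γ_{x,x′})», «shortest contour»), (3.3) p.390; Balaban1984PropagatorsII, (2.137) p.247] -/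
def HolderLipBY (cLip rL : ℝ) (par : Site (PV d ℓ i.m i.K hd hL) 0 → Site (PV d ℓ i.m i.K hd hL) 0 → 𝔸ˣ) (U : CfgY 𝔸 i) : Prop :=
  ∀ (Ψ : FBondY i → 𝔸) (x x' : FBondY i), Adm i x x' →
    ‖Ψ x - R (par x.src x'.src) (Ψ x')‖ ≤
      cLip * ((((supDist x.src x'.src : ℕ) : ℝ)) * |i.cf|⁻¹) * gradSupB i rL U Ψ (blkV1 i.hN i.D x)

/-! ## §2 The cut-off class of a bond cut-off; the weight identity -/

open Classical in
/-- the Hölder seminorm `‖ζ‖^ξ_α` of a bond cut-off over admissible ordered pairs (the second summand of `cutH`). [cite: Balaban1984PropagatorsII, (2.137) p.247, (2.67) p.234 («‖ζ‖_α»)] -/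
def holderSemi (α : ℝ) (ζ : FBondY i → ℝ) : ℝ :=
  ⨆ q : FBondY i × FBondY i, if Adm i q.1 q.2 then tpar i q.1 q.2 ^ (-α) * |ζ q.1 - ζ q.2| else 0

omit [NormedRing 𝔸] [NormedAlgebra ℂ 𝔸] [CompleteSpace 𝔸] in
/-- the (3.43) cut-off class of a bond cut-off unfolded: `cutH α (inr ζ) = |ζ| + ‖ζ‖^ξ_α`. [cite: Balaban1985BackgroundPropagators, (3.43) p.398 («‖ζ‖_α + |ζ|»), bookkeeping] -/
theorem cutH_inr_eq (α : ℝ) (ζ : FBondY i → ℝ) : (geo9K i).cutH α (Sum.inr ζ) = (⨆ f, |ζ f|) + holderSemi i α ζ := rfl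

omit [NormedRing 𝔸] [NormedAlgebra ℂ 𝔸] [CompleteSpace 𝔸] in
/-- `|ζ(q)| ≤ |ζ|`. [cite: Balaban1985BackgroundPropagators, (3.43) p.398, bookkeeping] -/
theorem abs_le_cutSup (ζ : FBondY i → ℝ) (q : FBondY i) : |ζ q| ≤ ⨆ f, |ζ f| := le_ciSup (f := fun f => |ζ f|) (Finite.bddAbove_range _) q

omit [NormedRing 𝔸] [NormedAlgebra ℂ 𝔸] [CompleteSpace 𝔸] in
/-- `0 ≤ |ζ|`. [cite: Balaban1985BackgroundPropagators, (3.43) p.398, bookkeeping] -/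
theorem cutSup_nonneg (ζ : FBondY i → ℝ) : 0 ≤ ⨆ f, |ζ f| := Real.iSup_nonneg fun _ => abs_nonneg _

omit [NormedRing 𝔸] [NormedAlgebra ℂ 𝔸] [CompleteSpace 𝔸] in
/-- `0 ≤ ‖ζ‖^ξ_α`. [cite: Balaban1984PropagatorsII, (2.137) p.247, bookkeeping] -/
theorem holderSemi_nonneg (α : ℝ) (ζ : FBondY i → ℝ) : 0 ≤ holderSemi i α ζ := by
  classical
  unfold holderSemi
  refine Real.iSup_nonneg fun q => ?_
  split_ifs
  · exact mul_nonneg (Real.rpow_nonneg (tpar_nonneg i _ _) _) (abs_nonneg _)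
  · exact le_rfl

omit [NormedRing 𝔸] [NormedAlgebra ℂ 𝔸] [CompleteSpace 𝔸] in
/-- every admissible ordered pair is below the seminorm: `t(x,x′)^{−α}·|ζ(x) − ζ(x′)| ≤ ‖ζ‖^ξ_α`. [cite: Balaban1984PropagatorsII, (2.137) p.247, bookkeeping] -/
theorem pair_le_holderSemi (α : ℝ) (ζ : FBondY i → ℝ) {x x' : FBondY i} (h : Adm i x x') : tpar i x x' ^ (-α) * |ζ x - ζ x'| ≤ holderSemi i α ζ := by
  classical
  have := le_ciSup (f := fun q : FBondY i × FBondY i => (if Adm i q.1 q.2 then tpar i q.1 q.2 ^ (-α) * |ζ q.1 - ζ q.2| else 0))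
    (Finite.bddAbove_range _) (x, x')
  simpa only [holderSemi, if_pos h] using this

omit [NormedRing 𝔸] [NormedAlgebra ℂ 𝔸] [CompleteSpace 𝔸] in
/-- `0 ≤ cutH α (inr ζ)`. [cite: Balaban1985BackgroundPropagators, (3.43) p.398, bookkeeping] -/
theorem cutH_inr_nonneg (α : ℝ) (ζ : FBondY i → ℝ) : 0 ≤ (geo9K i).cutH α (Sum.inr ζ) := by
  rw [cutH_inr_eq]; exact add_nonneg (cutSup_nonneg i ζ) (holderSemi_nonneg i α ζ)

omit [NormedRing 𝔸] [NormedAlgebra ℂ 𝔸] [CompleteSpace 𝔸] in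
/-- the scale length of the block of a bond: `L^{j(y(x))}·η`. [cite: Balaban1984PropagatorsII, (2.1) p.224, dictionary] -/
def lenB (x : FBondY i) : ℝ := (((ℓ + 1 : ℕ) : ℝ)) ^ (blkV1 i.hN i.D x).1.1 * |i.cf|⁻¹

omit [NormedRing 𝔸] [NormedAlgebra ℂ 𝔸] [CompleteSpace 𝔸] in
/-- `0 < lenB`. [cite: Balaban1984PropagatorsII, (2.1) p.224, bookkeeping] -/
theorem lenB_pos (x : FBondY i) : 0 < lenB i x := by
  unfold lenB
  have : 0 < |i.cf| := abs_pos.2 i.hcf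
  positivity

omit [NormedRing 𝔸] [NormedAlgebra ℂ 𝔸] [CompleteSpace 𝔸] in
/-- ★ the weight identity behind the product rule: `(|x − x′|η)^{−α} = t(x,x′)^{−α}·(L^{j(y(x))}η)^{−α}` (dag-n06-d's `wK_eq_tpar_mul`, restated for `wB`).
[cite: Balaban1985BackgroundPropagators, (3.40)–(3.41) p.397; Balaban1984PropagatorsII, (2.137) p.247] -/
theorem wB_eq_tpar_mul (α : ℝ) (x x' : FBondY i) : wB i α x x' = tpar i x x' ^ (-α) * lenB i x ^ (-α) := by
  unfold wB lenB tpar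
  have hL : (0 : ℝ) < (((ℓ + 1 : ℕ) : ℝ)) ^ (blkV1 i.hN i.D x).1.1 := by positivity
  rw [← Real.mul_rpow (by positivity) (by positivity)]
  congr 1
  field_simp

omit [NormedRing 𝔸] [NormedAlgebra ℂ 𝔸] [CompleteSpace 𝔸] in
/-- on an admissible pair `|x − x′|_∞·η ≤ L^{j(y(x))}η`. [cite: Balaban1984PropagatorsII, (2.137) p.247, bookkeeping] -/
theorem supDist_mul_le_lenB {x x' : FBondY i} (h : Adm i x x') : (((supDist x.src x'.src : ℕ) : ℝ)) * |i.cf|⁻¹ ≤ lenB i x := by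
  unfold lenB
  have h1 : (((supDist x.src x'.src : ℕ) : ℝ)) ≤ (((ℓ + 1 : ℕ) : ℝ)) ^ (blkV1 i.hN i.D x).1.1 := by exact_mod_cast h.2.1
  exact mul_le_mul_of_nonneg_right h1 (inv_nonneg.2 (abs_nonneg _))

/-! ## §3 The undifferentiated probe `ζ·Ψ` -/

section Undiff

variable (par : Site (PV d ℓ i.m i.K hd hL) 0 → Site (PV d ℓ i.m i.K hd hL) 0 → 𝔸ˣ) (U : CfgY 𝔸 i)

omit [CompleteSpace 𝔸] in
/-- the probe numerator split: `ζ(x)Ψ(x) − R(p)(ζ(x′)Ψ(x′)) = ζ(x)·(Ψ(x) − R(p)Ψ(x′)) + (ζ(x) − ζ(x′))·R(p)Ψ(x′)`.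
[cite: Balaban1985BackgroundPropagators, (3.40) p.397, bookkeeping] -/
theorem num_split (p : 𝔸ˣ) (ζ : FBondY i → ℝ) (Ψ : FBondY i → 𝔸) (x x' : FBondY i) :
    (((ζ x : ℝ) : ℂ)) • Ψ x - R p ((((ζ x' : ℝ) : ℂ)) • Ψ x') =
      (((ζ x : ℝ) : ℂ)) • (Ψ x - R p (Ψ x')) + ((((ζ x - ζ x' : ℝ)) : ℂ)) • R p (Ψ x') := by
  rw [R_smul, Complex.ofReal_sub, sub_smul, smul_sub]
  abel

/-- ★★ **THE UNDIFFERENTIATED BOND PROBE** (r06's right-transfer premise (a′) in U-letters, bond sector): let `ζ` be a bond cut-off supported within block distance 1 of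
`βy`, `par` a transporter of unit norms obeying `HolderLipBY c_Lip r_L`, `0 ≦ α ≦ 1`, and `Ψ` a bond function with `‖Ψ(q)‖ ≦ A₀` on the blocks within 1 of `βy`,
`‖(∇_{U,μ}Ψ)(q)‖ ≦ A₁` on the blocks within `r_L + 1` of `βy`, and scale lengths `Λ₀ ≦ L^{j(y(q))}η ≦ Λ₁` on the blocks within 1 of `βy` (`0 < Λ₀`; `A₀, A₁, c_Lip, r_L ≧ 0`).
Then every admissible pair probe of `ζ·Ψ` is at most `(|ζ| + ‖ζ‖^ξ_α)·(Λ₀^{−α}·A₀ + c_Lip·Λ₁^{1−α}·A₁)`.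
[cite: Balaban1985BackgroundPropagators, (3.40) p.397, (3.43) p.398, (3.42) p.397, Thm 3.3 p.399; Balaban1984PropagatorsII, (2.137) p.247, (2.67) p.234 («‖ζ‖_α + |ζ|»)] -/
theorem probeB_undiff_le {cLip rL : ℝ} (hcLip : 0 ≤ cLip) (hLip : HolderLipBY i cLip rL par U)
    (hpar : ∀ s s' : Site (PV d ℓ i.m i.K hd hL) 0, ‖((par s s' : 𝔸ˣ) : 𝔸)‖ ≤ 1 ∧ ‖(((par s s')⁻¹ : 𝔸ˣ) : 𝔸)‖ ≤ 1)
    {α : ℝ} (hα0 : 0 ≤ α) (hα1 : α ≤ 1) (ζ : FBondY i → ℝ) (y : IBondY i)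
    (hζ : ∀ q, ζ q ≠ 0 → (geomT i.D).dist (blkV1 i.hN i.D q) (β i.hN i.D i.hk y) ≤ 1)
    (Ψ : FBondY i → 𝔸) {A₀ A₁ Λ₀ Λ₁ : ℝ} (hA₀ : 0 ≤ A₀) (hA₁ : 0 ≤ A₁) (hΛ₀ : 0 < Λ₀) (hΛ₁ : 0 ≤ Λ₁)
    (h0 : ∀ q, (geomT i.D).dist (blkV1 i.hN i.D q) (β i.hN i.D i.hk y) ≤ 1 → ‖Ψ q‖ ≤ A₀)
    (h1 : ∀ q (μ : Fin (d + 1)), (geomT i.D).dist (blkV1 i.hN i.D q) (β i.hN i.D i.hk y) ≤ rL + 1 → ‖cdB i U μ Ψ q‖ ≤ A₁)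
    (hlo : ∀ q, (geomT i.D).dist (blkV1 i.hN i.D q) (β i.hN i.D i.hk y) ≤ 1 → Λ₀ ≤ lenB i q)
    (hhi : ∀ q, (geomT i.D).dist (blkV1 i.hN i.D q) (β i.hN i.D i.hk y) ≤ 1 → lenB i q ≤ Λ₁)
    {x x' : FBondY i} (hadm : Adm i x x') :
    ‖probeB i par α ζ x x' Ψ‖ ≤ (geo9K i).cutH α (Sum.inr ζ) * (Λ₀ ^ (-α) * A₀ + cLip * Λ₁ ^ (1 - α) * A₁) := by
  classical
  have hMh := B9GeoLemma21KLevelV1.one_le_Mh i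
  have hP := B9GeoLemma21KLevelV1.one_le_P i
  have htri := (B6Geom246MultiLevelTorus.triangle_refl_nonneg_T i.D hMh hP).1
  -- the two sups of the cut-off class
  set S₀ : ℝ := ⨆ f, |ζ f| with hS₀
  set Hz : ℝ := holderSemi i α ζ with hHz
  have hcut : (geo9K i).cutH α (Sum.inr ζ) = S₀ + Hz := cutH_inr_eq i α ζ
  have hS₀0 : 0 ≤ S₀ := cutSup_nonneg i ζ
  have hHz0 : 0 ≤ Hz := holderSemi_nonneg i α ζ
  have hzS : ∀ q, |ζ q| ≤ S₀ := abs_le_cutSup i ζ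
  have hR : ∀ v : 𝔸, ‖R (par x.src x'.src) v‖ ≤ ‖v‖ := fun v => norm_R_le (hpar _ _).1 (hpar _ _).2 v
  set K : ℝ := Λ₀ ^ (-α) * A₀ + cLip * Λ₁ ^ (1 - α) * A₁ with hK
  have hK1 : 0 ≤ Λ₀ ^ (-α) * A₀ := mul_nonneg (Real.rpow_nonneg hΛ₀.le _) hA₀
  have hK2 : 0 ≤ cLip * Λ₁ ^ (1 - α) * A₁ := mul_nonneg (mul_nonneg hcLip (Real.rpow_nonneg hΛ₁ _)) hA₁
  have hK0 : 0 ≤ K := add_nonneg hK1 hK2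
  -- the point weight at a bond near `βy` is at most `Λ₀^{−α}`
  have hptw : ∀ q, (geomT i.D).dist (blkV1 i.hN i.D q) (β i.hN i.D i.hk y) ≤ 1 → lenB i q ^ (-α) ≤ Λ₀ ^ (-α) := fun q hq =>
    Real.rpow_le_rpow_of_nonpos hΛ₀ (hlo q hq) (by linarith)
  -- the point term anchored at a bond `q` with `ζ(q) ≠ 0`: `wB(q,q′)·|ζ(q) − ζ(q′)|·‖X‖ ≤ Hz·Λ₀^{−α}·A₀` whenever `‖X‖ ≤ ‖Ψ(q″)‖`, `ζ(q″) ≠ 0`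
  have hpoint : ∀ (q q' : FBondY i), Adm i q q' → ζ q ≠ 0 → ∀ (X : 𝔸) (q'' : FBondY i), ζ q'' ≠ 0 → ‖X‖ ≤ ‖Ψ q''‖ →
      wB i α q q' * (|ζ q - ζ q'| * ‖X‖) ≤ Hz * (Λ₀ ^ (-α) * A₀) := by
    intro q q' hqq hq X q'' hq'' hX
    rw [wB_eq_tpar_mul]
    have h1 := pair_le_holderSemi i α ζ hqq
    have h2 : lenB i q ^ (-α) * ‖X‖ ≤ Λ₀ ^ (-α) * A₀ :=
      mul_le_mul (hptw q (hζ q hq)) (hX.trans (h0 q'' (hζ q'' hq''))) (norm_nonneg _) (Real.rpow_nonneg hΛ₀.le _)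
    calc tpar i q q' ^ (-α) * lenB i q ^ (-α) * (|ζ q - ζ q'| * ‖X‖)
        = (tpar i q q' ^ (-α) * |ζ q - ζ q'|) * (lenB i q ^ (-α) * ‖X‖) := by ring
      _ ≤ Hz * (Λ₀ ^ (-α) * A₀) :=
        mul_le_mul h1 h2 (mul_nonneg (Real.rpow_nonneg (lenB_pos i q).le _) (norm_nonneg _)) hHz0
  -- the pair term anchored at `x` with `ζ(x) ≠ 0`: `wB(x,x′)·‖Ψ(x) − RΨ(x′)‖ ≤ c_Lip·Λ₁^{1−α}·A₁`
  have hpair : ζ x ≠ 0 → wB i α x x' * ‖Ψ x - R (par x.src x'.src) (Ψ x')‖ ≤ cLip * Λ₁ ^ (1 - α) * A₁ := by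
    intro hx
    have hxy := hζ x hx
    -- the gradient sup over the blocks within `r_L` of `y(x)` is at most `A₁`
    have hS : gradSupB i rL U Ψ (blkV1 i.hN i.D x) ≤ A₁ :=
      gradSupB_le i rL U Ψ _ hA₁ fun q μ hq => h1 q μ (by linarith [htri (blkV1 i.hN i.D q) (blkV1 i.hN i.D x) (β i.hN i.D i.hk y)])
    set D : ℝ := (((supDist x.src x'.src : ℕ) : ℝ)) * |i.cf|⁻¹ with hD
    have hD0 : 0 ≤ D := by positivity
    have hDle : D ≤ Λ₁ := (supDist_mul_le_lenB i hadm).trans (hhi x hxy)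
    -- the weight times the length: `D^{−α}·D ≤ Λ₁^{1−α}`
    have hwD : wB i α x x' * D ≤ Λ₁ ^ (1 - α) := by
      have hw : wB i α x x' = D ^ (-α) := rfl
      rw [hw]
      rcases hD0.eq_or_lt with hz | hpos
      · rw [← hz, mul_zero]; exact Real.rpow_nonneg hΛ₁ _
      · rw [show D ^ (-α) * D = D ^ (1 - α) by
          rw [show (1 : ℝ) - α = -α + 1 by ring, Real.rpow_add hpos, Real.rpow_one]]
        exact Real.rpow_le_rpow hD0 hDle (by linarith)
    calc wB i α x x' * ‖Ψ x - R (par x.src x'.src) (Ψ x')‖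
        ≤ wB i α x x' * (cLip * D * gradSupB i rL U Ψ (blkV1 i.hN i.D x)) := mul_le_mul_of_nonneg_left (hLip Ψ x x' hadm) (wB_nonneg i α x x')
      _ = cLip * (wB i α x x' * D) * gradSupB i rL U Ψ (blkV1 i.hN i.D x) := by ring
      _ ≤ cLip * Λ₁ ^ (1 - α) * A₁ :=
        mul_le_mul (mul_le_mul_of_nonneg_left hwD hcLip) hS (gradSupB_nonneg i rL U Ψ _) (mul_nonneg hcLip (Real.rpow_nonneg hΛ₁ _))
  -- the sup over the cases of the pair
  rw [norm_probeB, hcut]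
  by_cases hx : ζ x = 0 <;> by_cases hx' : ζ x' = 0
  · -- both vanish
    rw [hx, hx']
    simp only [Complex.ofReal_zero, zero_smul, R_zero, sub_zero, norm_zero, mul_zero]
    exact mul_nonneg (add_nonneg hS₀0 hHz0) hK0
  · -- `ζ(x) = 0 ≠ ζ(x′)`: one transported point term, weight through `t(x′, x)`
    rw [hx]
    simp only [Complex.ofReal_zero, zero_smul, zero_sub, norm_neg, R_smul, norm_ofReal_smul]
    have h := hpoint x' x (adm_symm i hadm) hx' (R (par x.src x'.src) (Ψ x')) x' hx' (hR _)
    rw [wB_comm, hx, sub_zero] at h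
    calc wB i α x x' * (|ζ x'| * ‖R (par x.src x'.src) (Ψ x')‖) ≤ Hz * (Λ₀ ^ (-α) * A₀) := h
      _ ≤ (S₀ + Hz) * K := by
          rw [hK]; nlinarith [mul_nonneg hS₀0 hK0, mul_nonneg hHz0 hK2]
  · -- `ζ(x) ≠ 0 = ζ(x′)`: one point term, weight through `t(x, x′)`
    rw [hx']
    simp only [Complex.ofReal_zero, zero_smul, R_zero, sub_zero, norm_ofReal_smul]
    have h := hpoint x x' hadm hx (Ψ x) x hx le_rfl
    rw [hx', sub_zero] at h
    calc wB i α x x' * (|ζ x| * ‖Ψ x‖) ≤ Hz * (Λ₀ ^ (-α) * A₀) := h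
      _ ≤ (S₀ + Hz) * K := by
          rw [hK]; nlinarith [mul_nonneg hS₀0 hK0, mul_nonneg hHz0 hK2]
  · -- both non-zero: the product rule
    rw [num_split]
    have hsplit : wB i α x x' * ‖(((ζ x : ℝ) : ℂ)) • (Ψ x - R (par x.src x'.src) (Ψ x')) +
        ((((ζ x - ζ x' : ℝ)) : ℂ)) • R (par x.src x'.src) (Ψ x')‖ ≤
        |ζ x| * (wB i α x x' * ‖Ψ x - R (par x.src x'.src) (Ψ x')‖) + wB i α x x' * (|ζ x - ζ x'| * ‖R (par x.src x'.src) (Ψ x')‖) := by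
      calc wB i α x x' * ‖(((ζ x : ℝ) : ℂ)) • (Ψ x - R (par x.src x'.src) (Ψ x')) + ((((ζ x - ζ x' : ℝ)) : ℂ)) • R (par x.src x'.src) (Ψ x')‖
          ≤ wB i α x x' * (|ζ x| * ‖Ψ x - R (par x.src x'.src) (Ψ x')‖ + |ζ x - ζ x'| * ‖R (par x.src x'.src) (Ψ x')‖) := by
            refine mul_le_mul_of_nonneg_left ((norm_add_le _ _).trans ?_) (wB_nonneg i α x x')
            rw [norm_ofReal_smul, norm_ofReal_smul]
        _ = _ := by ring
    refine hsplit.trans ?_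
    have t1 : |ζ x| * (wB i α x x' * ‖Ψ x - R (par x.src x'.src) (Ψ x')‖) ≤ S₀ * (cLip * Λ₁ ^ (1 - α) * A₁) :=
      mul_le_mul (hzS x) (hpair hx) (mul_nonneg (wB_nonneg i α x x') (norm_nonneg _)) hS₀0
    have t2 := hpoint x x' hadm hx (R (par x.src x'.src) (Ψ x')) x' hx' (hR _)
    calc |ζ x| * (wB i α x x' * ‖Ψ x - R (par x.src x'.src) (Ψ x')‖) + wB i α x x' * (|ζ x - ζ x'| * ‖R (par x.src x'.src) (Ψ x')‖)
        ≤ S₀ * (cLip * Λ₁ ^ (1 - α) * A₁) + Hz * (Λ₀ ^ (-α) * A₀) := add_le_add t1 t2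
      _ ≤ (S₀ + Hz) * K := by
          rw [hK]; nlinarith [mul_nonneg hS₀0 hK1, mul_nonneg hHz0 hK2]

end Undiff

end Literature.MathematicalPhysics.QuantumFieldTheory.Balaban1983to89.B9SectBH1GUndiffY

end
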